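import Mathlib.Analysis.SpecialFunctions.Pow.Continuity
import Mathlib.MeasureTheory.Function.LpSeminorm.Basic
import Literature.Probability.RandomPlanarGeometry.ImageUnivalent
import Literature.Probability.RandomPlanarGeometry.LatticeSlitIncrements
import HarnessLib

/-!
# The tip-normalised uniformizer of an infinite slit and the one-step Loewner data at the tip

Definition file (request `defn-TipNormalisedUniformizer` of route `SAWTipEnvironment` of
`CriticalPhenomena/SAWScalingLimit`, idea card *ergodic-loewner-tip-environment-v2*, D2). The
route reads a lattice walk not in the CHORDAL frame of a bounded Dobrushin domain (the tree's
`LatticeSlit.drivingValue`, `LatticeSlit.drivingIncrement`, `hcapOf`, `tipValue` of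
`LatticeSlitIncrements`) but in the WHOLE-PLANE frame of its own infinite past: the complement
`ℂ ∖ E` of an infinite simple polygonal path `E` ending at the tip `0` is mapped onto the upper
half-plane `ℍ` with the tip sent to `0` and `∞` to `∞`. Such a map is unique up to the dilations
`z ↦ c z` (`c > 0`) of `ℍ`; since there is no hydrodynamic normalisation at `∞` for an infinite
slit, the dilation is fixed AT THE TIP: near the end of the last (straight) edge, which enters the
tip in the direction `u` (`|u| = 1`, the edge is `[-ℓu, 0]`), every such map is
`c · i · (z/u)^{1/2} + O(|z|)` with `c > 0` (Schwarz reflection across the edge; principal branch,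
whose cut `z/u ∈ (-∞, 0]` is the edge itself near the tip), and we demand `c = 1`.

## Contents

Set level (namespace `Literature.Probability.RandomPlanarGeometry`):

* `TipNormalisedUniformizer E u φ` — the predicate: `φ : ℂ → ℂ` restricts to a conformal
  bijection `ℂ ∖ E → ℍ`, sends `∞` to `∞` (`φ → ∞` along `cocompact ℂ ⊓ 𝓟 Eᶜ`) and is
  normalised at the tip by `φ(z) · (z/u)^(-1/2) → i` (`z → 0` in `ℂ ∖ E`). Consequences proved
  here: the tip lies on `E` (`zero_mem`) and is sent to `0` (`tendsto_zero`). EXISTENCE (Riemann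
  mapping for slit planes, boundary correspondence at the two ends of the Jordan arc `E ∪ {∞}`,
  square-root behaviour at an analytic slit end) and UNIQUENESS (automorphisms of `ℍ` fixing
  `0, ∞` are dilations) are separate statements, NOT in this file; the two-sided continuous
  extension to the slit (Carathéodory) is likewise a theorem about, not a clause of, the notion.
* `tipUniformizer E u` — a chosen tip-normalised uniformizer (junk `0` if there is none).
* the ONE-STEP LOEWNER DATA of a step from the tip `0` to a point `s` (`(0, s] ⊆ ℂ ∖ E`) read
  through `φ`, in the tree's half-plane vocabulary: the image slit
  `tipStepHull φ s = Fill_ℍ (closure φ((0, s]))` (a slit of `ℍ` growing from `φ(tip) = 0`),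
  `tipDrivingIncrement φ s = g_K(φ(s))` (`tipValue`; Kennedy's `ΔU`: the driving value before the
  step is `0`), `tipCapIncrement φ s = hcap(K)/2` (Kennedy's `Δt`, "`2Δt_i` the capacity of the
  map `h_i`"), the map `tipStepMap φ s = g_K ∘ φ - ΔU` of `ℂ ∖ (E ∪ [0, s])` onto `ℍ` (Kennedy's
  `h = g - U`, "sends the tip to the origin"), and the SCALE RATIO
  `tipScaleRatio φ s = lim_{z → s} |tipStepMap φ s z| / |z - s|^{1/2}`, the positive number `ρ`
  with `tipStepMap φ s = ρ · φ_{E ∪ [0,s]}(· - s)` relating the step map to the tip-normalised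
  uniformizer of the grown slit re-centred at its tip (so that, by `g_{ρA}(z) = ρ g_A(z/ρ)` and
  `hcap(ρA) = ρ² hcap(A)`, Lawler (2005) p. 69, the `E`-frame driving function of a lattice
  future `s₁, s₂, …` is `Σ_k c_k ΔU(E_k, s_{k+1})` at capacity times `Σ_k c_k² Δt(E_k, s_{k+1})`
  with the multiplicative cocycle `c_k = Π_{j<k} ρ(E_j, s_{j+1})`; in the chordal frame of
  Kennedy (2008) §3 all `c_k = 1` and "`t = Σ Δt_i`, `U_t = Σ ΔU_i`").

Lattice level (namespace `Literature.Probability.RandomPlanarGeometry.LatticePast`), for an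
infinite lattice past `E : ℕ → Site 2` listed backwards from the tip `E 0` (ROOTED: `E 0 = 0`)
at mesh `1`, a one-step continuation kernel `p : (ℕ → Site 2) → Site 2 → ℝ` (`p E s` = the
probability that the next vertex is the neighbour `s` of the tip given the past `E`; supplied by
the user, e.g. the kernel of Kesten's two-sided measure of the separate request
`KestenTwoSidedSAW`) and a law `μ` on bi-infinite paths `ω : ℤ → Site 2`:

* `trace E`, `dir E`, `uniformizer E = φ_E`, the step data `dW E s`, `dt E s`, `scaleRatio E s`;
* `reRoot E s` (the past after the step to `s`, re-rooted at the new tip) and `ofBiInfinite ω`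
  (the past of `ω` seen from `ω 0`), with `reRoot (ofBiInfinite ω) (ω 1 - ω 0) = ofBiInfinite
  (shift ω)` for the re-rooting shift `ω ↦ ω(· + 1) - ω 1` (`reRoot_ofBiInfinite`);
* the LOEWNER DRIFT `loewnerDrift p E = Σ_s p(s|E) dW(E, s)`, the conditional variance
  `loewnerVariance p E = Σ_s p(s|E) (dW(E, s) - b(E))²`, the clock
  `loewnerClock p E = Σ_s p(s|E) dt(E, s)` (sums over the lattice neighbours `s` of the tip);
* the transfer operator `transfer p f E = Σ_s p(s|E) f(reRoot E s)` of the
  past-seen-from-the-tip chain (Maxwell–Woodroofe's `Q`), the sums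
  `projectiveSum p f n = Σ_{k<n} Pᵏ f` (their `V_n f = Σ_{k=0}^{n-1} Qᵏ f`, with
  `V_n g(x) = E[S_n(g) | X_1 = x]`) and the PROJECTIVE NORM
  `projectiveNorm μ p f n = ‖V_n f ∘ ofBiInfinite‖_{L²(μ)}` (`eLpNorm`, in `ℝ≥0∞`), the quantity
  of the projective criterion `Σ_n n^{-3/2} ‖V_n g‖ < ∞` (Maxwell–Woodroofe (2000), (2)).

## References

* G. F. Lawler, *Conformally Invariant Processes in the Plane*, AMS (2005) [Lawler2005], §3.4
  (Prop. 3.36 `g_A`; Def. 3.37 `hcap`; p. 69: `g_{rA}(z) = r g_A(z/r)`, `hcap(rA) = r² hcap(A)`),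
  §4.1 (Lemma 4.2: `U_t = lim_{z → γ(t)} g_t(z)`).
* T. Kennedy, *Computing the Loewner driving process of random curves in the half plane*,
  J. Stat. Phys. 131 (2008), arXiv:math/0702071 [Kennedy2008Driving], §3 ("`h_s = g_s - U_s` …
  sends the tip `γ(s)` to the origin"; "let `2Δt_i` be the capacity of the map `h_i`, and `ΔU_i`
  the final value of the driving function for `h_i` … `t = Σ Δt_i`, `U_t = Σ ΔU_i`"; the
  vertical-slit map `h(z) = i √(-(z-x)² - y²)`, "the branch cut for the square root is the
  negative real axis").
* M. Maxwell, M. Woodroofe, *Central limit theorems for additive functionals of Markov chains*,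
  Ann. Probab. 28 (2000) 713–724 [MaxwellWoodroofe2000], p. 714 (`Q`, `V_n = Σ_{k<n} Qᵏ`,
  condition (2) `Σ n^{-3/2} ‖V_n g‖ < ∞`).

## Junk conventions

All objects are total. `tipUniformizer E u = 0` when no tip-normalised uniformizer exists;
`tipDrivingIncrement`, `tipCapIncrement` inherit the junk values of `tipValue` / `hcapOf`
(value `0` without a hydrodynamic map or a boundary limit); `tipScaleRatio` is a `limUnder`
(unspecified when the limit fails to exist); the lattice objects read `E` literally and are
meant for ROOTED pasts (`E 0 = 0`, which `reRoot` and `ofBiInfinite` produce); kernels are only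
evaluated at lattice neighbours of the tip; `projectiveNorm` is `⊤` off `L²`.
-/

noncomputable section

open Set Filter Topology Metric Bornology Complex MeasureTheory
open scoped ENNReal
open UpperHalfPlane (upperHalfPlaneSet)
open Literature.Probability.LatticeModels (Site zdGraph)

namespace Literature.Probability.RandomPlanarGeometry

/-! ### (i) Tip-normalised uniformizers of an infinite slit -/

/-- **Tip-normalised uniformizer.** For a closed set `E ⊆ ℂ` (an infinite simple polygonal path
ending at the tip `0`, whose last edge enters the tip in the unit direction `u`) and
`φ : ℂ → ℂ`: `φ` restricts to a conformal bijection of `ℂ ∖ E` onto the open upper half-plane,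
sends `∞` to `∞`, and is normalised at the tip by `φ(z) · (z/u)^(-1/2) → i` as `z → 0` in
`ℂ ∖ E` (principal branch of the power: its cut `z/u ∈ (-∞, 0]` is the last edge near the tip,
so `i (z/u)^{1/2}` is the uniformizer of the plane slit along the ray `-u · [0, ∞)`). The
normalisation forces `0 ∈ E` (`zero_mem`) and tip `↦ 0` (`tendsto_zero`); it replaces the
hydrodynamic normalisation at `∞` of the chordal maps `g_A` (Lawler (2005), Prop. 3.36), which is
unavailable for an infinite slit, and kills the residual dilation freedom `z ↦ c z` of a map
`(ℂ ∖ E; 0, ∞) → (ℍ; 0, ∞)`. Only the restriction of `φ` to `ℂ ∖ E` matters. [folklore] -/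
structure TipNormalisedUniformizer (E : Set ℂ) (u : ℂ) (φ : ℂ → ℂ) : Prop where
  /-- `φ` is a bijection of `ℂ ∖ E` onto `ℍ`. -/
  bijOn : BijOn φ Eᶜ upperHalfPlaneSet
  /-- `φ` is holomorphic on `ℂ ∖ E`. -/
  differentiableOn : DifferentiableOn ℂ φ Eᶜ
  /-- `∞ ↦ ∞`: `φ(z) → ∞` as `z → ∞` in `ℂ ∖ E`. -/
  tendsto_cocompact : Tendsto φ (cocompact ℂ ⊓ 𝓟 Eᶜ) (cocompact ℂ)
  /-- The normalisation at the tip: `φ(z) (z/u)^(-1/2) → i` as `z → 0` in `ℂ ∖ E`. -/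
  tendsto_tip : Tendsto (fun z ↦ φ z * (z / u) ^ (-(1 / 2 : ℂ))) (𝓝[Eᶜ] 0) (𝓝 I)

namespace TipNormalisedUniformizer

variable {E : Set ℂ} {u : ℂ} {φ : ℂ → ℂ}

/-- A tip-normalised uniformizer maps `ℂ ∖ E` into `ℍ`. [folklore] -/
theorem mapsTo (h : TipNormalisedUniformizer E u φ) : MapsTo φ Eᶜ upperHalfPlaneSet :=
  h.bijOn.mapsTo

/-- **The tip lies on the slit**: the normalisation at `0` cannot hold at the point `0` itself
(there the principal power `0^(-1/2)` is the junk `0`), so `0 ∉ ℂ ∖ E`. [folklore] -/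
theorem zero_mem (h : TipNormalisedUniformizer E u φ) : (0 : ℂ) ∈ E := by
  by_contra h0
  have hle : pure (0 : ℂ) ≤ 𝓝[Eᶜ] 0 := by
    rw [← nhdsWithin_singleton]
    exact nhdsWithin_mono _ (singleton_subset_iff.2 h0)
  have h1 := h.tendsto_tip.mono_left hle
  have hval : φ 0 * ((0 : ℂ) / u) ^ (-(1 / 2 : ℂ)) = 0 := by
    rw [zero_div, zero_cpow (by norm_num), mul_zero]
  have h2 : φ 0 * ((0 : ℂ) / u) ^ (-(1 / 2 : ℂ)) = I :=
    tendsto_nhds_unique (tendsto_pure_nhds (fun z ↦ φ z * (z / u) ^ (-(1 / 2 : ℂ))) 0) h1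
  exact I_ne_zero (h2.symm.trans hval)

/-- **The tip is sent to `0`**: `φ(z) → 0` as `z → 0` in `ℂ ∖ E` (`u ≠ 0`), since
`φ(z) = [φ(z) (z/u)^(-1/2)] · (z/u)^(1/2)` off `0` and `(z/u)^(1/2) → 0`. [folklore] -/
theorem tendsto_zero (h : TipNormalisedUniformizer E u φ) (hu : u ≠ 0) :
    Tendsto φ (𝓝[Eᶜ] 0) (𝓝 0) := by
  have hhalf : (1 / 2 : ℂ) ≠ 0 := by norm_num
  -- `(z/u)^(1/2) → 0` as `z → 0`
  have h1 : Tendsto (fun z : ℂ ↦ (z / u) ^ (1 / 2 : ℂ)) (𝓝[Eᶜ] 0) (𝓝 0) := by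
    have hc : ContinuousAt (fun x : ℂ × ℂ ↦ x.1 ^ x.2) (0, (1 / 2 : ℂ)) :=
      continuousAt_cpow_zero_of_re_pos (by norm_num)
    have h0 : Tendsto (fun z : ℂ ↦ (z / u, (1 / 2 : ℂ))) (𝓝 0) (𝓝 (0, (1 / 2 : ℂ))) := by
      have hdiv : Tendsto (fun z : ℂ ↦ z / u) (𝓝 0) (𝓝 0) := by
        simpa using ((continuous_id.div_const u).tendsto (0 : ℂ))
      exact hdiv.prodMk_nhds tendsto_const_nhds
    have h2 := hc.tendsto.comp h0
    rw [zero_cpow hhalf] at h2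
    exact h2.mono_left nhdsWithin_le_nhds
  have h2 := h.tendsto_tip.mul h1
  rw [mul_zero] at h2
  refine h2.congr' ?_
  have h0E : (0 : ℂ) ∈ E := h.zero_mem
  filter_upwards [self_mem_nhdsWithin] with z hz
  have hz0 : z ≠ 0 := fun hz0 ↦ hz (hz0 ▸ h0E)
  have hzu : z / u ≠ 0 := div_ne_zero hz0 hu
  have hne : (z / u) ^ (1 / 2 : ℂ) ≠ 0 := fun h' ↦ hzu ((cpow_eq_zero_iff _ _).1 h').1
  rw [cpow_neg, mul_assoc, inv_mul_cancel₀ hne, mul_one]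

/-- **The bundled conformal equivalence `ℂ ∖ E → ℍ`** of a tip-normalised uniformizer (`E`
closed): forward map `φ`, inverse `Function.invFunOn φ Eᶜ`, holomorphic by the inverse function
theorem for injective holomorphic maps (`ConformalEquiv.ofInjOn`). [folklore] -/
def conformalEquiv (h : TipNormalisedUniformizer E u φ) (hE : IsClosed E) :
    ConformalEquiv Eᶜ upperHalfPlaneSet :=
  ConformalEquiv.ofInjOn φ hE.isOpen_compl h.differentiableOn h.bijOn.injOn h.bijOn.image_eq

/-- The bundled equivalence acts as `φ`. [folklore] -/
@[simp] theorem conformalEquiv_apply (h : TipNormalisedUniformizer E u φ) (hE : IsClosed E) (z : ℂ) :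
    h.conformalEquiv hE z = φ z := rfl

end TipNormalisedUniformizer

/-- **The model case: the square root.** For the ray `E = (-∞, 0]` (direction `u = 1`; `ℂ ∖ E`
is Mathlib's `Complex.slitPlane`) the map `z ↦ i z^{1/2}` (principal branch) is a tip-normalised
uniformizer: it is a holomorphic bijection of the slit plane onto `ℍ` (inverse `w ↦ (-iw)²`,
`Complex.sq_cpow_two_inv`), `|i z^{1/2}| = |z|^{1/2} → ∞`, and `i z^{1/2} z^{-1/2} = i` off `0`.
This is Kennedy's vertical-slit map at `x = y = 0` ("`h(z) = i√(-z²)`" composed with `z ↦ z²`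
undone), and the local model at every analytic slit end. [folklore] -/
theorem tipNormalisedUniformizer_sqrt :
    TipNormalisedUniformizer slitPlaneᶜ 1 (fun z ↦ I * z ^ (2⁻¹ : ℂ)) where
  bijOn := by
    rw [compl_compl]
    refine ⟨fun z hz ↦ ?_, fun z₁ _ z₂ _ h ↦ ?_, fun w hw ↦ ?_⟩
    · -- `Im (i z^{1/2}) = Re z^{1/2} = √((|z| + Re z)/2) > 0`
      show 0 < (I * z ^ (2⁻¹ : ℂ)).im
      rw [I_mul_im, cpow_inv_two_re]
      refine Real.sqrt_pos.2 (div_pos ?_ two_pos)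
      rcases hz with hz | hz
      · linarith [norm_nonneg z]
      · have := abs_re_lt_norm.2 hz
        linarith [neg_abs_le z.re]
    · have h' : z₁ ^ (2⁻¹ : ℂ) = z₂ ^ (2⁻¹ : ℂ) := mul_left_cancel₀ I_ne_zero h
      rw [← cpow_ofNat_inv_pow z₁ 2, ← cpow_ofNat_inv_pow z₂ 2, h']
    · -- `w = i v` with `Re v = Im w > 0`; take `z = v²`
      set v : ℂ := -I * w with hv
      have hvre : 0 < v.re := by simpa [hv] using (show 0 < w.im from hw)
      refine ⟨v ^ 2, ?_, ?_⟩
      · rw [mem_slitPlane_iff]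
        by_cases hvim : v.im = 0
        · left
          have : (v ^ 2).re = v.re * v.re - v.im * v.im := by rw [sq, mul_re]
          rw [this, hvim, mul_zero, sub_zero]
          positivity
        · right
          have : (v ^ 2).im = v.re * v.im + v.im * v.re := by rw [sq, mul_im]
          rw [this]
          have h2 : v.re * v.im + v.im * v.re = 2 * (v.re * v.im) := by ring
          rw [h2]
          exact mul_ne_zero two_ne_zero (mul_ne_zero hvre.ne' hvim)
      · show I * (v ^ 2) ^ (2⁻¹ : ℂ) = w
        rw [sq_cpow_two_inv hvre, hv, ← mul_assoc, mul_neg, I_mul_I, neg_neg, one_mul]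
  differentiableOn := by
    rw [compl_compl]
    intro z hz
    exact ((differentiableAt_id.cpow (differentiableAt_const (2⁻¹ : ℂ)) hz).const_mul
      I).differentiableWithinAt
  tendsto_cocompact := by
    refine Tendsto.mono_left ?_ inf_le_left
    rw [← cobounded_eq_cocompact, ← tendsto_norm_atTop_iff_cobounded]
    have h1 : Tendsto (fun z : ℂ ↦ ‖z‖ ^ (2⁻¹ : ℝ)) (cobounded ℂ) atTop :=
      (tendsto_rpow_atTop (by norm_num)).comp tendsto_norm_cobounded_atTop
    refine h1.congr fun z ↦ ?_
    rw [norm_mul, norm_I, one_mul, show (2⁻¹ : ℂ) = ((2⁻¹ : ℝ) : ℂ) by norm_num, norm_cpow_real]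
  tendsto_tip := by
    refine tendsto_const_nhds.congr' ?_
    rw [compl_compl]
    filter_upwards [self_mem_nhdsWithin] with z hz
    have hz0 : z ≠ 0 := slitPlane_ne_zero hz
    have hne : z ^ (2⁻¹ : ℂ) ≠ 0 := fun h' ↦ hz0 ((cpow_eq_zero_iff _ _).1 h').1
    rw [div_one, one_div, cpow_neg, mul_assoc, mul_inv_cancel₀ hne, mul_one]

open Classical in
/-- **A chosen tip-normalised uniformizer `φ_E` of `ℂ ∖ E`** (direction `u` of the last edge),
by choice among the maps satisfying `TipNormalisedUniformizer E u`; the junk value `0` when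
there is none. Existence and uniqueness are separate statements. [folklore] -/
def tipUniformizer (E : Set ℂ) (u : ℂ) : ℂ → ℂ :=
  if h : ∃ φ, TipNormalisedUniformizer E u φ then Classical.choose h else 0

/-- The chosen map is a tip-normalised uniformizer as soon as one exists. [folklore] -/
theorem tipNormalisedUniformizer_tipUniformizer {E : Set ℂ} {u : ℂ}
    (h : ∃ φ, TipNormalisedUniformizer E u φ) : TipNormalisedUniformizer E u (tipUniformizer E u) := by
  rw [tipUniformizer, dif_pos h]
  exact Classical.choose_spec h

/-- Without a tip-normalised uniformizer, `tipUniformizer E u = 0` (junk). [folklore] -/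
theorem tipUniformizer_of_not {E : Set ℂ} {u : ℂ} (h : ¬ ∃ φ, TipNormalisedUniformizer E u φ) :
    tipUniformizer E u = 0 := by
  rw [tipUniformizer, dif_neg h]

/-! ### (ii) The one-step Loewner data of a step at the tip -/

section Step

variable (φ : ℂ → ℂ) (s : ℂ)

/-- **The image slit `K = Fill_ℍ (closure φ((0, s]))` of the step `[0, s]`** from the tip `0` to
`s`, read through `φ`: the closure re-attaches the arc `φ((0, s]) ⊆ ℍ` to `ℝ` at `φ(tip) = 0`
(independently of the junk value `φ 0`), and the fill (`hpFill`, [LSW] "Fillings", as for the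
tree's `LatticeSlit.pastHull`) makes it a hull whenever it is bounded; for a simple arc it is the
arc itself (Lawler (2005), §4.1: `ℍ ∖ γ(0, t]`). [cite: Lawler2005, §4.1 (p. 94)] -/
def tipStepHull : Set ℂ :=
  hpFill (closure (φ '' (segment ℝ 0 s \ {0})))

/-- **The driving increment `ΔU` of the step**: the boundary value `g_K(φ(s))` of the
hydrodynamic map of the image slit `K = tipStepHull φ s` at its tip `φ(s)` (`tipValue`, Lawler's
`U_t = lim_{z → γ(t)} g_t(z)`, Lemma 4.2); as the driving value before the step is `φ(tip) = 0`,
this is Kennedy's one-step increment "`ΔU_i`, the final value of the driving function for `h_i`".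
[cite: Kennedy2008Driving, §3] -/
def tipDrivingIncrement : ℝ :=
  tipValue (tipStepHull φ s) (φ s)

/-- **The capacity increment `Δt = hcap(K)/2` of the step** (`hcapOf`, Lawler (2005), Def. 3.37,
in the Loewner clock `hcap(K_t) = 2t`; Kennedy (2008), §3: "let `2Δt_i` be the capacity of the
map `h_i`"). [cite: Kennedy2008Driving, §3] -/
def tipCapIncrement : ℝ :=
  hcapOf (tipStepHull φ s) / 2

/-- **The step map `h = g_K ∘ φ - ΔU`** (with `g_K` the reflected hydrodynamic map `hydroFun K`
of the image slit): a conformal map of `ℂ ∖ (E ∪ [0, s])` onto `ℍ` sending the new tip `s` to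
`0` and `∞` to `∞` — Kennedy (2008), §3: "`h_s = g_s - U_s` … sends the tip `γ(s)` to the
origin". It is a tip-normalised uniformizer of the grown slit re-centred at `s` up to the
dilation `tipScaleRatio φ s`. [cite: Kennedy2008Driving, §3] -/
def tipStepMap : ℂ → ℂ := fun z ↦
  hydroFun (tipStepHull φ s) (φ z) - tipDrivingIncrement φ s

/-- **The scale ratio `ρ` of the step**: `ρ = lim_{z → s, z ∉ [0, s]} |h(z)| / |z - s|^{1/2}` for
the step map `h = tipStepMap φ s`. Near the end `s` of the straight edge `[0, s]` (direction
`u' = s/|s|`) one has `h(z) = ρ · i · ((z - s)/u')^{1/2} + O(|z - s|)` with `ρ > 0` (Schwarz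
reflection), so `ρ` is the positive dilation with `h = ρ · φ'(· - s)` for the tip-normalised
uniformizer `φ'` of the translate `(E ∪ [0, s]) - s`; consequently (Lawler (2005), p. 69:
`g_{ρA}(z) = ρ g_A(z/ρ)`, `hcap(ρA) = ρ² hcap(A)`) driving increments of later steps read in the
`E`-frame are multiplied by the product of the intermediate `ρ`'s and capacity increments by its
square. A `limUnder` (junk when the limit fails to exist). [folklore] -/
def tipScaleRatio : ℝ :=
  limUnder (𝓝[(segment ℝ 0 s)ᶜ] s) (fun z ↦ ‖tipStepMap φ s z‖ / Real.sqrt ‖z - s‖)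

variable {φ s}

/-- `2 Δt = hcap(K)`: the capacity increment is half the half-plane capacity of the image slit.
[cite: Lawler2005, §4.1 Remark 4.5 with §3.4 Def. 3.37] -/
theorem two_mul_tipCapIncrement : 2 * tipCapIncrement φ s = hcapOf (tipStepHull φ s) := by
  rw [tipCapIncrement]; ring

/-- The capacity increment is nonnegative as soon as the image slit is bounded in `ℍ`
(`hcap ≥ 0`, Lawler (2005), (3.8); trivially in the junk case). [cite: Lawler2005, §3.4 (3.8)] -/
theorem tipCapIncrement_nonneg (hb : IsBounded (tipStepHull φ s ∩ upperHalfPlaneSet)) :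
    0 ≤ tipCapIncrement φ s := by
  have := hcapOf_nonneg hb
  rw [tipCapIncrement]
  linarith

/-- The step map, unfolded: `h(z) = g_K(φ(z)) - ΔU`. [folklore] -/
theorem tipStepMap_apply (z : ℂ) :
    tipStepMap φ s z = hydroFun (tipStepHull φ s) (φ z) - tipDrivingIncrement φ s := rfl

end Step

/-! ### (iii) Lattice pasts seen from the tip: step data, Loewner drift, transfer operator -/

namespace LatticePast

/-- **The polygonal trace** of an infinite lattice past `E : ℕ → Site 2` (listed backwards from
the tip `E 0`, mesh `1`): the union of the closed edges `[E (n+1), E n]`. [folklore] -/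
def trace (E : ℕ → Site 2) : Set ℂ :=
  ⋃ n : ℕ, segment ℝ (Site.toComplex (E (n + 1))) (Site.toComplex (E n))

/-- **The direction `u = E 0 - E 1` of the last edge** (a unit complex number for a
nearest-neighbour past; `-E 1` for a rooted past). [folklore] -/
def dir (E : ℕ → Site 2) : ℂ :=
  Site.toComplex (E 0) - Site.toComplex (E 1)

/-- **The tip-normalised uniformizer `φ_E` of the past** (rooted past, tip `0`): the chosen
`tipUniformizer` of `ℂ ∖ trace E` with the direction of the last edge. [folklore] -/
def uniformizer (E : ℕ → Site 2) : ℂ → ℂ :=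
  tipUniformizer (trace E) (dir E)

/-- **`dW(E, s)`**: the driving increment of the lattice step from the tip to the site `s`, read
through `φ_E` (Kennedy's `ΔU` in the whole-plane frame). [cite: Kennedy2008Driving, §3] -/
def dW (E : ℕ → Site 2) (s : Site 2) : ℝ :=
  tipDrivingIncrement (uniformizer E) (Site.toComplex s)

/-- **`dt(E, s)`**: the capacity increment (half the half-plane capacity) of the lattice step from
the tip to `s`, read through `φ_E` (Kennedy's `Δt`). [cite: Kennedy2008Driving, §3] -/
def dt (E : ℕ → Site 2) (s : Site 2) : ℝ :=
  tipCapIncrement (uniformizer E) (Site.toComplex s)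

/-- **`ρ(E, s)`**: the scale ratio of the lattice step from the tip to `s` (`tipScaleRatio`),
relating `φ_{E ∪ [0,s]}` re-centred at `s` to the step map `g ∘ φ_E - dW`. [folklore] -/
def scaleRatio (E : ℕ → Site 2) (s : Site 2) : ℝ :=
  tipScaleRatio (uniformizer E) (Site.toComplex s)

/-- **Re-rooting after a step**: the past after the walk at the tip of `E` steps to the site `s`,
listed backwards from and translated to the new tip (`0 ↦ 0`, `n + 1 ↦ E n - s`). [folklore] -/
def reRoot (E : ℕ → Site 2) (s : Site 2) : ℕ → Site 2
  | 0 => 0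
  | n + 1 => E n - s

/-- **The past of a bi-infinite path seen from its present tip**: `n ↦ ω(-n) - ω 0` (rooted at
the tip `ω 0`; under a law carried by `{ω 0 = 0}` the subtraction is void). [folklore] -/
def ofBiInfinite (ω : ℤ → Site 2) : ℕ → Site 2 :=
  fun n ↦ ω (-(n : ℤ)) - ω 0

/-- `reRoot` at the new tip. [folklore] -/
@[simp] theorem reRoot_zero (E : ℕ → Site 2) (s : Site 2) : reRoot E s 0 = 0 := rfl

/-- `reRoot` behind the new tip. [folklore] -/
@[simp] theorem reRoot_succ (E : ℕ → Site 2) (s : Site 2) (n : ℕ) :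
    reRoot E s (n + 1) = E n - s := rfl

/-- The past seen from the tip is rooted. [folklore] -/
@[simp] theorem ofBiInfinite_zero (ω : ℤ → Site 2) : ofBiInfinite ω 0 = 0 := by
  simp [ofBiInfinite]

/-- **Re-rooting is the past of the shifted path**: stepping from the tip `ω 0` to `ω 1` and
re-rooting gives the past, seen from its tip, of the re-rooted shift `k ↦ ω(k + 1) - ω 1` (the
shift under which Kesten-type measures are stationary). [folklore] -/
theorem reRoot_ofBiInfinite (ω : ℤ → Site 2) :
    reRoot (ofBiInfinite ω) (ω 1 - ω 0) = ofBiInfinite (fun k ↦ ω (k + 1) - ω 1) := by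
  funext n
  cases n with
  | zero => simp [ofBiInfinite]
  | succ n =>
    rw [reRoot_succ, ofBiInfinite, ofBiInfinite]
    have h1 : (-((n + 1 : ℕ) : ℤ) + 1) = -(n : ℤ) := by push_cast; ring
    simp only [h1, zero_add]
    abel

variable (p : (ℕ → Site 2) → Site 2 → ℝ)

/-- **The Loewner drift `b(E) = Σ_s p(s|E) dW(E, s)`**: the conditional mean, under the one-step
continuation kernel `p` (evaluated at the lattice neighbours `s` of the tip), of the driving
increment of the next step read through `φ_E` — the one-step conditional drift of Kennedy's
`U_t = Σ ΔU_i` along the walk. [cite: Kennedy2008Driving, §3] -/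
def loewnerDrift (E : ℕ → Site 2) : ℝ :=
  ∑ s ∈ (zdGraph 2).neighborFinset (E 0), p E s * dW E s

/-- **The conditional variance `v(E) = Σ_s p(s|E) (dW(E, s) - b(E))²`** of the next driving
increment. [cite: Kennedy2008Driving, §3] -/
def loewnerVariance (E : ℕ → Site 2) : ℝ :=
  ∑ s ∈ (zdGraph 2).neighborFinset (E 0), p E s * (dW E s - loewnerDrift p E) ^ 2

/-- **The clock `τ(E) = Σ_s p(s|E) dt(E, s)`**: the conditional mean capacity increment of the
next step (Kennedy's `t = Σ Δt_i`). [cite: Kennedy2008Driving, §3] -/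
def loewnerClock (E : ℕ → Site 2) : ℝ :=
  ∑ s ∈ (zdGraph 2).neighborFinset (E 0), p E s * dt E s

/-- **The transfer operator `(P f)(E) = Σ_s p(s|E) f(reRoot E s)`** of the past-seen-from-the-tip
chain with one-step kernel `p` (Maxwell–Woodroofe's `Qh(x) = ∫ h(y) Q(x; dy)`).
[cite: MaxwellWoodroofe2000, p. 714] -/
def transfer (f : (ℕ → Site 2) → ℝ) (E : ℕ → Site 2) : ℝ :=
  ∑ s ∈ (zdGraph 2).neighborFinset (E 0), p E s * f (reRoot E s)

/-- **The projective sums `V_n f = Σ_{k<n} Pᵏ f`** (Maxwell–Woodroofe (2000), p. 714: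
`V_n h = Σ_{k=0}^{n-1} Qᵏ h`, so that `V_n g(x) = E[S_n(g) | X_1 = x]`).
[cite: MaxwellWoodroofe2000, p. 714] -/
def projectiveSum (f : (ℕ → Site 2) → ℝ) (n : ℕ) : (ℕ → Site 2) → ℝ :=
  ∑ k ∈ Finset.range n, (transfer p)^[k] f

/-- **The projective norm `‖V_n f‖_{L²(μ)}`** of a functional `f` of the past under a law `μ` on
bi-infinite paths (read through `ofBiInfinite`), as an extended seminorm `eLpNorm · 2 μ`; the
Maxwell–Woodroofe criterion for the CLT of `S_n(f)` is `Σ_n n^{-3/2} ‖V_n f‖ < ∞` (2000, (2)),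
implied by any power saving `‖V_n f‖ = O(n^{1/2 - ε})`. [cite: MaxwellWoodroofe2000, p. 714 (2)] -/
def projectiveNorm (μ : Measure (ℤ → Site 2)) (f : (ℕ → Site 2) → ℝ) (n : ℕ) : ℝ≥0∞ :=
  eLpNorm (fun ω ↦ projectiveSum p f n (ofBiInfinite ω)) 2 μ

variable {p}

/-- `V_0 f = 0`. [cite: MaxwellWoodroofe2000, p. 714] -/
@[simp] theorem projectiveSum_zero (f : (ℕ → Site 2) → ℝ) : projectiveSum p f 0 = 0 := by
  simp [projectiveSum]

/-- `V_{n+1} f = V_n f + Pⁿ f`. [cite: MaxwellWoodroofe2000, p. 714] -/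
theorem projectiveSum_succ (f : (ℕ → Site 2) → ℝ) (n : ℕ) :
    projectiveSum p f (n + 1) = projectiveSum p f n + (transfer p)^[n] f := by
  rw [projectiveSum, projectiveSum, Finset.sum_range_succ]

/-- `V_1 f = f`. [cite: MaxwellWoodroofe2000, p. 714] -/
@[simp] theorem projectiveSum_one (f : (ℕ → Site 2) → ℝ) : projectiveSum p f 1 = f := by
  rw [projectiveSum_succ, projectiveSum_zero, Function.iterate_zero, zero_add, id]

/-- The transfer operator is linear: `P (f + g) = P f + P g`. [cite: MaxwellWoodroofe2000, p. 714] -/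
theorem transfer_add (f g : (ℕ → Site 2) → ℝ) : transfer p (f + g) = transfer p f + transfer p g := by
  funext E
  simp only [transfer, Pi.add_apply, mul_add, Finset.sum_add_distrib]

/-- The transfer operator is linear: `P (c • f) = c • P f`. [cite: MaxwellWoodroofe2000, p. 714] -/
theorem transfer_smul (c : ℝ) (f : (ℕ → Site 2) → ℝ) : transfer p (c • f) = c • transfer p f := by
  funext E
  simp only [transfer, Pi.smul_apply, smul_eq_mul, Finset.mul_sum]
  refine Finset.sum_congr rfl fun s _ ↦ ?_
  ring

/-- For a kernel of total mass `1` at `E`, `P` fixes constants: `(P c)(E) = c`.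
[cite: MaxwellWoodroofe2000, p. 714] -/
theorem transfer_const {E : ℕ → Site 2} (hp : ∑ s ∈ (zdGraph 2).neighborFinset (E 0), p E s = 1)
    (c : ℝ) : transfer p (fun _ ↦ c) E = c := by
  rw [transfer, ← Finset.sum_mul, hp, one_mul]

/-- **The variance identity** `v(E) = Σ_s p(s|E) dW(E, s)² - b(E)²` for a kernel of total mass `1`
at `E`. [folklore] -/
theorem loewnerVariance_eq {E : ℕ → Site 2}
    (hp : ∑ s ∈ (zdGraph 2).neighborFinset (E 0), p E s = 1) :
    loewnerVariance p E =
      (∑ s ∈ (zdGraph 2).neighborFinset (E 0), p E s * dW E s ^ 2) - loewnerDrift p E ^ 2 := by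
  set b := loewnerDrift p E with hb
  have hb' : ∑ s ∈ (zdGraph 2).neighborFinset (E 0), p E s * dW E s = b := rfl
  have hexp : ∀ s, p E s * (dW E s - b) ^ 2 =
      p E s * dW E s ^ 2 - 2 * b * (p E s * dW E s) + b ^ 2 * p E s := fun s ↦ by ring
  rw [loewnerVariance, ← hb, Finset.sum_congr rfl fun s _ ↦ hexp s, Finset.sum_add_distrib,
    Finset.sum_sub_distrib, ← Finset.mul_sum, ← Finset.mul_sum, hb', hp]
  ring

end LatticePast

end Literature.Probability.RandomPlanarGeometry
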